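import Mathlib
import Summits.Ventures.HodgeRepro2.T5HodgeStar

/-!
# T5HodgeStarUnique — the Hodge operator is determined by `γ ∧ *δ = (γ, δ) Vol` (Voisin Def. 5.3)

Tier-5 support for sub-step N1 (Hodge-theoretic side; memo route/T5-N1-hodge-p6.md §H2.1).
H2.1 uses the Hodge operator «characterised by `γ ∧ *δ = (γ, δ) Vol_s`» (Voisin Definition 5.3 /
Lemma 5.4, [C] V3); `T5HodgeStar` DEFINES `*` by its sign table and PROVES the identity
(`wedge_hodgeStar_of_real`).  This file closes the remaining gap between the two readings: the
identity determines `*` uniquely, because the pairing `wedge` is non-degenerate.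

* `bil`: the ℂ-bilinear extension `Σ γ_i δ_i` of the real metric on 2-covectors (`herm` without
  the conjugation; equal to `herm γ δ` for real `δ`); `wedge_hodgeStar_eq_bil`:
  `γ ∧ *δ = bil γ δ` for ALL complex `γ, δ`;
* `wedge_single`, `eq_zero_of_forall_wedge_eq_zero`: the pairing `wedge` is non-degenerate
  (testing against the six basis covectors);
* `hodgeStar_unique` / `hodgeStar_unique_of_real`: any map `T` with `γ ∧ T δ = (γ, δ)` for all
  `γ, δ` (or, for a ℂ-linear `T`, for all real `δ`) is `hodgeStar` — so the printed
  characterisation and the sign table define the same operator.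

Blind lane (cell pub-hodge-repro2): `import Mathlib` + own `T5HodgeStar`, 0 sorry, standard axioms.
-/

namespace Summit.Ventures.HodgeRepro2.T5HodgeStarUnique

open Summit.Ventures.HodgeRepro2.T5HodgeStar Complex

/-- The ℂ-bilinear form `Σ_i γ_i δ_i` on 2-covectors: the complex-bilinear extension of the real
metric with the six wedges orthonormal (`herm γ δ` without the conjugation). -/
def bil (γ δ : TwoCovector) : ℂ := ∑ i, γ i * δ i

/-- For a real `δ` (`conjC δ = δ`) the bilinear form agrees with the hermitian one. -/
theorem bil_eq_herm_of_real (γ δ : TwoCovector) (hδ : conjC δ = δ) : bil γ δ = herm γ δ := by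
  unfold bil herm
  refine Finset.sum_congr rfl fun i _ => ?_
  have : (starRingEnd ℂ) (δ i) = δ i := congrFun hδ i
  rw [this]

/-- `γ ∧ *δ = bil γ δ` for all complex 2-covectors — Voisin Lemma 5.4 / Definition 5.3 extended
ℂ-bilinearly (the model's `*` is the ℂ-linear extension of the real operator). -/
theorem wedge_hodgeStar_eq_bil (γ δ : TwoCovector) : wedge γ (hodgeStar δ) = bil γ δ := by
  simp only [wedge, hodgeStar, bil, Fin.sum_univ_six]
  simp
  ring

/-- The pairing of a covector with a basis covector picks out one coefficient (up to the sign of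
the complementary pair): the values `wedge (Pi.single j 1) δ` for `j = 0, …, 5` are
`δ 5, −δ 4, δ 3, δ 2, −δ 1, δ 0`. -/
theorem wedge_single (δ : TwoCovector) :
    wedge (Pi.single 0 1) δ = δ 5 ∧ wedge (Pi.single 1 1) δ = -δ 4 ∧
      wedge (Pi.single 2 1) δ = δ 3 ∧ wedge (Pi.single 3 1) δ = δ 2 ∧
      wedge (Pi.single 4 1) δ = -δ 1 ∧ wedge (Pi.single 5 1) δ = δ 0 := by
  simp [wedge]

/-- Non-degeneracy of the pairing `wedge`: a covector paired to zero against everything is zero. -/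
theorem eq_zero_of_forall_wedge_eq_zero {δ : TwoCovector} (h : ∀ γ, wedge γ δ = 0) : δ = 0 := by
  obtain ⟨h0, h1, h2, h3, h4, h5⟩ := wedge_single δ
  rw [h (Pi.single 0 1)] at h0
  rw [h (Pi.single 1 1)] at h1
  rw [h (Pi.single 2 1)] at h2
  rw [h (Pi.single 3 1)] at h3
  rw [h (Pi.single 4 1)] at h4
  rw [h (Pi.single 5 1)] at h5
  ext i
  fin_cases i
  · show δ 0 = 0
    exact h5.symm
  · show δ 1 = 0
    exact neg_eq_zero.mp h4.symm
  · show δ 2 = 0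
    exact h3.symm
  · show δ 3 = 0
    exact h2.symm
  · show δ 4 = 0
    exact neg_eq_zero.mp h1.symm
  · show δ 5 = 0
    exact h0.symm

/-- Two covectors with the same pairings against everything are equal. -/
theorem ext_of_forall_wedge_eq {δ δ' : TwoCovector} (h : ∀ γ, wedge γ δ = wedge γ δ') : δ = δ' := by
  have hsub : ∀ γ, wedge γ (δ - δ') = 0 := by
    intro γ
    have : wedge γ (δ - δ') = wedge γ δ - wedge γ δ' := by
      simp only [wedge, Pi.sub_apply]
      ring
    rw [this, h γ, sub_self]
  exact sub_eq_zero.mp (eq_zero_of_forall_wedge_eq_zero hsub)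

/-- Uniqueness of the Hodge operator: any `T` satisfying Voisin's characterisation
`γ ∧ T δ = (γ, δ) Vol` (bilinear form) for all `γ, δ` coincides with the sign-table `hodgeStar` of
`T5HodgeStar`.  So Definition 5.3 as printed and the model's definition agree. -/
theorem hodgeStar_unique (T : TwoCovector → TwoCovector)
    (hT : ∀ γ δ, wedge γ (T δ) = bil γ δ) : T = hodgeStar := by
  funext δ
  refine ext_of_forall_wedge_eq fun γ => ?_
  rw [hT, wedge_hodgeStar_eq_bil]

/-- The same with the characterisation stated for real `δ` only and `T` ℂ-linear (the form in which
Voisin states it, extended by ℂ-linearity as on p0105 l. 6). -/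
theorem hodgeStar_unique_of_real (T : TwoCovector →ₗ[ℂ] TwoCovector)
    (hT : ∀ γ δ, conjC δ = δ → wedge γ (T δ) = herm γ δ) : ⇑T = hodgeStar := by
  refine hodgeStar_unique T fun γ δ => ?_
  -- split δ = re δ + I • im δ into two real covectors
  have hre : conjC (fun i => ((δ i).re : ℂ)) = fun i => ((δ i).re : ℂ) := by
    funext i; simp [conjC]
  have him : conjC (fun i => ((δ i).im : ℂ)) = fun i => ((δ i).im : ℂ) := by
    funext i; simp [conjC]
  have hδ : δ = (fun i => ((δ i).re : ℂ)) + I • fun i => ((δ i).im : ℂ) := by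
    funext i
    simp only [Pi.add_apply, Pi.smul_apply, smul_eq_mul]
    rw [mul_comm]
    exact (Complex.re_add_im (δ i)).symm
  have hlin : ∀ δ₁ δ₂ : TwoCovector, ∀ c : ℂ,
      wedge γ (T (δ₁ + c • δ₂)) = wedge γ (T δ₁) + c * wedge γ (T δ₂) := by
    intro δ₁ δ₂ c
    rw [map_add, map_smul]
    simp only [wedge, Pi.add_apply, Pi.smul_apply, smul_eq_mul]
    ring
  have hbil : ∀ δ₁ δ₂ : TwoCovector, ∀ c : ℂ, bil γ (δ₁ + c • δ₂) = bil γ δ₁ + c * bil γ δ₂ := by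
    intro δ₁ δ₂ c
    simp only [bil, Pi.add_apply, Pi.smul_apply, smul_eq_mul, mul_add, Finset.sum_add_distrib,
      Finset.mul_sum]
    refine congrArg₂ (· + ·) rfl (Finset.sum_congr rfl fun i _ => ?_)
    ring
  rw [hδ, hlin, hbil, hT _ _ hre, hT _ _ him, bil_eq_herm_of_real _ _ hre,
    bil_eq_herm_of_real _ _ him]

end Summit.Ventures.HodgeRepro2.T5HodgeStarUnique
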